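import Mathlib
import Summits.NavierStokesRegularity.OSWSelfSimilar.SheetNSLineTorusCascadeKernelTwentyFour
import Summits.NavierStokesRegularity.OSWSelfSimilar.SheetNSLineTorusCascadeDataMonotone
import Summits.NavierStokesRegularity.OSWSelfSimilar.SheetNSLineTorusCascadeLinkGeneral
import HarnessLib

/-!
# Viscous CLM on the torus (`a = 0`, `σ = 2`): the datum-free `24ν` threshold CARRIES TO EVERY ODD DATUM WITH NONNEGATIVE ANALYTIC-SIGNAL
# COEFFICIENTS (first mode `a₁ ≥ 24ν`) — cascade level and PDE level

HONEST FRAMING (cell ns-blowup GROUP B «PROFILE SEARCH», zone Z3, row Z3-U addendum A-F2 of `HOME/profile/z3/CENSUS-Z3.md`;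
human rulings D-0035/D-0074; Z3-TWIN lineage): **1-D MODEL (viscous Constantin–Lax–Majda equation `ω_t = ω Hω + ν ω_xx` on `𝕋`,
`H = hilbertTransformCircle`); composition of kernel theorems, no new estimate; not Euler, not Navier–Stokes; «violates: none — MODEL».
NO script datum.**

WHAT (answers RULING (ig)(2) «whether 27ν carries to the general odd class»): eng-3 g9's transfer slots — the data-monotonicity principle
`IsNonnegCascade.unbounded_of_sine_unbounded` (`SheetNSLineTorusCascadeDataMonotone`, p520447: the explicit sine cascade with `c = e 1 0` lies
below every nonnegative-coefficient cascade `e`) and the general-datum PDE link `horizon_lt_of_sine_unbounded_gen` (`SheetNSLineTorusCascadeLinkGeneral`,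
p521478: odd data `ω₀ = −Σ a_k sin kx`, `a_k ≥ 0`, mean zero) — take as input exactly what the datum-free certificate
`unbounded_of_le_twentyFour` (`SheetNSLineTorusCascadeKernelTwentyFour`) proves for the sine cascade with `c = a₁`. Hence:
* `IsNonnegCascade.unbounded_of_le_twentyFour` — every nonnegative-coefficient cascade with `0 < ν`, `24ν ≤ e 1 0` is unbounded in `k` at
  `t = log 2/ν` (was `48ν`, `IsNonnegCascade.unbounded_of_le`); `IsNonnegCascade.first_mode_lt_twentyFour_of_bounded` (census form);
* `horizon_lt_log_two_of_le_twentyFour_gen` — **no classical `2π`-periodic solution of the MODEL PDE from ANY odd datum with nonnegative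
  analytic-signal coefficients and `a₁ ≥ 24ν` exists on `[0, log 2/ν]`** (was `48ν`, `horizon_lt_log_two_div_gen`); census form
  `first_coef_lt_twentyFour_of_classicalSolution`.
The same two lines with `unbounded_of_le_thirtyOne` / `…twentySeven` give the `31ν` / `27ν` versions (not restated). bears_on: LADDER-NS N5 / zone Z3
(row Z3-U) → N1 linear core. WHAT THIS IS NOT: not NS; no definitions; nothing numerical outside the kernel.
-/

namespace Summit.NavierStokesRegularity.OSWSelfSimilar
namespace SheetNSLineTorusCascade

open Finset Real Set

variable {ν : ℝ} {e : ℕ → ℝ → ℝ}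

/-- **`24ν` FOR EVERY NONNEGATIVE-COEFFICIENT DATUM (cascade level, datum-free).** A nonnegative cascade with `0 < ν` and first mode
`e 1 0 ≥ 24ν` has `k ↦ e_k(log 2/ν)` unbounded above. [new here — MODEL] -/
theorem IsNonnegCascade.unbounded_of_le_twentyFour (he : IsNonnegCascade ν e) (hν : 0 < ν) (hc : 24 * ν ≤ e 1 0) :
    ∀ M : ℝ, ∃ k : ℕ, M < e k (Real.log 2 / ν) :=
  he.unbounded_of_sine_unbounded (div_pos (Real.log_pos (by norm_num)) hν).le
    (SheetNSLineTorusCascade.unbounded_of_le_twentyFour (isSineCascade_cascadeSolution ν (e 1 0)) hν hc)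

/-- Census form: a nonnegative cascade bounded at `t = log 2/ν` (`ν > 0`) has first mode `< 24ν`. [new here — MODEL] -/
theorem IsNonnegCascade.first_mode_lt_twentyFour_of_bounded (he : IsNonnegCascade ν e) (hν : 0 < ν)
    (hbdd : ∃ M : ℝ, ∀ k : ℕ, e k (Real.log 2 / ν) ≤ M) : e 1 0 < 24 * ν := by
  by_contra h
  obtain ⟨M, hM⟩ := hbdd
  obtain ⟨k, hk⟩ := he.unbounded_of_le_twentyFour hν (not_lt.mp h) M
  exact absurd (hM k) (not_le.mpr hk)

/-- **`24ν` FOR EVERY ODD DATUM WITH NONNEGATIVE ANALYTIC-SIGNAL COEFFICIENTS (PDE level, datum-free).** If `ω` is a classical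
`2π`-periodic solution of `ω_t = ω·Hω + ν ω_xx` on `[0, T]` whose datum has cascade variables `coef ω k 0 = a_k ∈ ℝ`, `a_k ≥ 0`, mean zero,
and `a₁ ≥ 24ν` (`ν > 0`), then `T < log 2/ν`. [new here — MODEL] -/
theorem horizon_lt_log_two_of_le_twentyFour_gen {T : ℝ} {ω ωt ωx ωxx : ℝ → ℝ → ℝ} (h : IsClassicalSolution ν T ω ωt ωx ωxx)
    {a : ℕ → ℝ} (hdat : ∀ k : ℕ, coef ω k 0 = ((a k : ℝ) : ℂ)) (ha : ∀ k, 0 ≤ a k) (hmean : mode ω 0 0 = 0)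
    (hν : 0 < ν) (hc : 24 * ν ≤ a 1) : T < Real.log 2 / ν :=
  horizon_lt_of_sine_unbounded_gen h hdat ha hmean (div_pos (Real.log_pos (by norm_num)) hν)
    (SheetNSLineTorusCascade.unbounded_of_le_twentyFour (isSineCascade_cascadeSolution ν (a 1)) hν hc)

/-- Census form at the PDE level: a classical solution from such a datum that exists on `[0, T]` with `log 2/ν ≤ T` has `a₁ < 24ν`.
[new here — MODEL] -/
theorem first_coef_lt_twentyFour_of_classicalSolution {T : ℝ} {ω ωt ωx ωxx : ℝ → ℝ → ℝ}
    (h : IsClassicalSolution ν T ω ωt ωx ωxx) {a : ℕ → ℝ} (hdat : ∀ k : ℕ, coef ω k 0 = ((a k : ℝ) : ℂ)) (ha : ∀ k, 0 ≤ a k)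
    (hmean : mode ω 0 0 = 0) (hν : 0 < ν) (hT : Real.log 2 / ν ≤ T) : a 1 < 24 * ν := by
  by_contra hcon
  exact absurd hT (not_le.mpr (horizon_lt_log_two_of_le_twentyFour_gen h hdat ha hmean hν (not_lt.mp hcon)))

end SheetNSLineTorusCascade
end Summit.NavierStokesRegularity.OSWSelfSimilar
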